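import Summits.QuantumFields.GaugeBoot.LoopEquation
import HarnessLib

/-!
# The one-link Schwinger–Dyson identity with one SPECTATOR loop: merge terms and the two-word pair identity (gauge-boot, Lean layer, ADDENDUM 22 part B, file 1/2)

HONEST FRAMING (cell `pub-gaugeboot`, page 1 of every file): the venture produces certified bounds
on lattice expectations at stated coupling, gauge group, dimension and torus size; NOT a mass gap,
NOT a continuum limit, NOT a string tension; NOT Yang–Mills-summit-bearing (barriers
`FixedCouplingUltralocality`, `PerturbativeInvisibility`).  This file enters no number: it is the
exact Schwinger–Dyson identity behind the double-trace rows of the finite-`N` bootstrap.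

## Content

`SchwingerDysonPair.lean` / `LoopEquation.lean` contract the tree's one-link Schwinger–Dyson identity against the
test function `tr(E_ji ρ(hol w))`.  Here the test function carries one more loop factor,
`tr(Y ρ(hol_{x₀} w))·tr ρ(hol_{x₁} v)` (Kazakov–Zheng 2024 §2.3: "the variation of `W[C]_{ab} Π_i W[C_i] e^{−S}`", one
spectator).  By the product rule (`sd_pair₂`, from the tree's `integral_shiftDeriv_eq_wilson`):

`∫ (tr(Y·insDeriv_X hol w)·tr ρ(hol v) + tr(Y ρ(hol w))·tr(insDeriv_X hol v)) dμ_β = β ∫ tr(Y ρ(hol w))·tr ρ(hol v)·(−½ plaqIns_X) dμ_β`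

for admissible skew-Hermitian `X`; the predicate `SDPair₂` and its polarisation to all (traceless) directions
(`sdPair₂_of_traceless`, `sdPair₂_of_skew`).  Contracting the NEW term over the matrix units produces the MERGE TERMS
(`mergeTerm`, `sum_trace_mul_trace_insDeriv_unitDir`): at every traversal of the edge `e = (x, μ)` by the spectator,
`±( tr ρ(hol_x w · hol v⟲k') − (s/N)·tr ρ(hol w)·tr ρ(hol v) )` (`v⟲k'` the spectator re-based at its `k'`-th letter;
`+` forward, `−` backward).  The assembled two-word loop equation is in `LoopEquationTwoWords.lean`.

References: V. Kazakov, Z. Zheng, arXiv:2404.16925 §2.3 (multi-trace loop equations at finite `N`);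
S. Chatterjee, arXiv:1502.07719 §3; cell file MM-DERIVATION.md §6.  Everything is `[folklore]` given the tree's
Schwinger–Dyson identity.
-/

noncomputable section

open MeasureTheory Filter Topology NormedSpace
open scoped Matrix.Norms.Frobenius Matrix
open Literature.MathematicalPhysics.QuantumFieldTheory
open Summit.QuantumFields.YangMills.Cruxes.CurvatureAmnesia.WardDefect.SchwingerDyson

namespace Summit.QuantumFields.GaugeBoot

variable {d L N : ℕ} {G : Type} [Group G] {ρ : G →* Matrix (Fin N) (Fin N) ℂ}


/-! ## Merge terms and their contraction -/

section MergeTerms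

variable (ρ) in
/-- The `k`-th MERGE TERM of the two-word loop equation at the edge `e = (x, μ)`: the marked loop `w` (closed at `x`)
joined with the spectator `v` (read from `x₁`) at a traversal of `e` by the `k`-th letter of `v` — at a forward one
`tr ρ(hol_x w · hol v[k,n) · hol v[0,k)) − (s/N)·tr ρ(hol w)·tr ρ(hol v)`, at a backward one
`−(tr ρ(hol_x w · hol v(k,n) · hol v[0,k]) − (s/N)·tr ρ(hol w)·tr ρ(hol v))`, else `0` (KZ2024 §2.3's joining
term; weight `s = 1` for `SU(N)`, `0` for `U(N)`). [folklore] -/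
def mergeTerm (s : ℂ) (x : Site d L) (μ : Fin d) (U : GaugeConfig d L G) (w : Word d) (x₁ : Site d L) (v : Word d)
    (k : ℕ) : ℂ :=
  match v[k]? with
  | none => 0
  | some st =>
    if st.edge (Word.siteAt x₁ v k) = (x, μ) then
      (if st.isFwd then
        (ρ (wordHolonomy U x w) * (ρ (wordHolonomy U (Word.siteAt x₁ v k) (v.drop k)) *
            ρ (wordHolonomy U x₁ (v.take k)))).trace -
          (s / N) * ((ρ (wordHolonomy U x w)).trace * (ρ (wordHolonomy U x₁ v)).trace)
      else
        -((ρ (wordHolonomy U x w) * (ρ (wordHolonomy U (Word.siteAt x₁ v (k + 1)) (v.drop (k + 1))) *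
            ρ (wordHolonomy U x₁ (v.take (k + 1))))).trace -
          (s / N) * ((ρ (wordHolonomy U x w)).trace * (ρ (wordHolonomy U x₁ v)).trace)))
    else 0

/-- `tr(A·X·B) = tr(X·(B·A))`. [folklore] -/
theorem trace_sandwich_cycle (A X B : Matrix (Fin N) (Fin N) ℂ) : (A * X * B).trace = (X * (B * A)).trace := by
  rw [Matrix.mul_assoc, Matrix.trace_mul_comm, Matrix.mul_assoc]

/-- The trace of the re-based spectator: `tr(ρ(hol v[k,n))·ρ(hol v[0,k))) = tr ρ(hol v)`. [folklore] -/
theorem trace_drop_mul_take (U : GaugeConfig d L G) (x₁ : Site d L) (v : Word d) (k : ℕ) :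
    (ρ (wordHolonomy U (Word.siteAt x₁ v k) (v.drop k)) * ρ (wordHolonomy U x₁ (v.take k))).trace =
      (ρ (wordHolonomy U x₁ v)).trace := by
  rw [Matrix.trace_mul_comm, ← map_mul, wordHolonomy_take_drop]

/-- **Merge contraction**: `Σ_ij tr(E_ji ρ(hol w))·occTerm_k(X_ij, Y = 1; v) = mergeTerm_k(w, v)`. [folklore] -/
theorem sum_trace_mul_occTerm_unitDir (s : ℂ) (x : Site d L) (μ : Fin d) (U : GaugeConfig d L G) (w : Word d)
    (x₁ : Site d L) (v : Word d) (k : ℕ) :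
    ∑ i : Fin N, ∑ j : Fin N, (Matrix.single j i (1 : ℂ) * ρ (wordHolonomy U x w)).trace *
        occTerm ρ (x, μ) (unitDir s i j) 1 U x₁ v k = mergeTerm ρ s x μ U w x₁ v k := by
  unfold occTerm mergeTerm
  cases v[k]? with
  | none => simp
  | some st =>
    simp only
    split_ifs
    · simp only [Matrix.one_mul, trace_sandwich_cycle _ (unitDir s _ _), sum_trace_mul_trace_unitDir,
        trace_drop_mul_take]
    · simp only [Matrix.one_mul, trace_sandwich_cycle _ (unitDir s _ _), mul_neg, Finset.sum_neg_distrib,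
        sum_trace_mul_trace_unitDir, trace_drop_mul_take]
    · simp

/-- **Contracted merge side, pointwise**: `Σ_ij tr(E_ji ρ(hol w))·tr(insDeriv_{X_ij} hol v) = Σ_{k'} mergeTerm_{k'}`.
[folklore] -/
theorem sum_trace_mul_trace_insDeriv_unitDir (s : ℂ) (x : Site d L) (μ : Fin d) (U : GaugeConfig d L G) (w : Word d)
    (x₁ : Site d L) (v : Word d) :
    ∑ i : Fin N, ∑ j : Fin N, (Matrix.single j i (1 : ℂ) * ρ (wordHolonomy U x w)).trace *
        (insDeriv ρ (x, μ) (unitDir s i j) U x₁ v).trace =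
      ∑ k ∈ Finset.range v.length, mergeTerm ρ s x μ U w x₁ v k := by
  have h1 : ∀ i j : Fin N, (insDeriv ρ (x, μ) (unitDir s i j) U x₁ v).trace =
      ∑ k ∈ Finset.range v.length, occTerm ρ (x, μ) (unitDir s i j) 1 U x₁ v k := fun i j => by
    rw [← trace_mul_insDeriv, Matrix.one_mul]
  simp only [h1, Finset.mul_sum]
  calc ∑ i : Fin N, ∑ j : Fin N, ∑ k ∈ Finset.range v.length,
        (Matrix.single j i (1 : ℂ) * ρ (wordHolonomy U x w)).trace * occTerm ρ (x, μ) (unitDir s i j) 1 U x₁ v k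
      = ∑ i : Fin N, ∑ k ∈ Finset.range v.length, ∑ j : Fin N,
        (Matrix.single j i (1 : ℂ) * ρ (wordHolonomy U x w)).trace * occTerm ρ (x, μ) (unitDir s i j) 1 U x₁ v k :=
        Finset.sum_congr rfl fun _ _ => Finset.sum_comm
    _ = ∑ k ∈ Finset.range v.length, ∑ i : Fin N, ∑ j : Fin N,
        (Matrix.single j i (1 : ℂ) * ρ (wordHolonomy U x w)).trace * occTerm ρ (x, μ) (unitDir s i j) 1 U x₁ v k :=
        Finset.sum_comm
    _ = ∑ k ∈ Finset.range v.length, mergeTerm ρ s x μ U w x₁ v k :=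
        Finset.sum_congr rfl fun k _ => sum_trace_mul_occTerm_unitDir s x μ U w x₁ v k

variable [TopologicalSpace G] [IsTopologicalGroup G] (r : LatticeRep G)

/-- Continuity of the merge terms. [folklore] -/
theorem continuous_mergeTerm (s : ℂ) (x : Site d L) (μ : Fin d) (w : Word d) (x₁ : Site d L) (v : Word d) (k : ℕ) :
    Continuous fun U : GaugeConfig d L G => mergeTerm r.ρ s x μ U w x₁ v k := by
  unfold mergeTerm
  cases v[k]? with
  | none => exact continuous_const
  | some st =>
    simp only
    split_ifs
    · exact (((r.continuous.comp (continuous_wordHolonomy x w)).mul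
          ((r.continuous.comp (continuous_wordHolonomy _ _)).mul
            (r.continuous.comp (continuous_wordHolonomy x₁ _)))).matrix_trace).sub
        (continuous_const.mul ((continuous_trace_wordHolonomy r x w).mul (continuous_trace_wordHolonomy r x₁ v)))
    · exact ((((r.continuous.comp (continuous_wordHolonomy x w)).mul
          ((r.continuous.comp (continuous_wordHolonomy _ _)).mul
            (r.continuous.comp (continuous_wordHolonomy x₁ _)))).matrix_trace).sub
        (continuous_const.mul ((continuous_trace_wordHolonomy r x w).mul
          (continuous_trace_wordHolonomy r x₁ v)))).neg
    · exact continuous_const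

end MergeTerms

/-! ## The two-word Schwinger–Dyson identity (pair form) and its polarisation -/

section SDPair₂

variable [TopologicalSpace G] [IsTopologicalGroup G] [CompactSpace G] [MeasurableSpace G] [BorelSpace G]
  (r : LatticeRep G)

/-- **The one-link Schwinger–Dyson identity for a word with one spectator (pair form).**  For an admissible
direction `X` (skew-Hermitian, `r.ρ(k t) = exp(tX)` along a one-parameter subgroup `k`), ANY matrix `Y`, a word `w`
from `x₀`, a spectator word `v` from `x₁` and the edge `e = (x, μ)` (product rule in the tree's identity):
`∫ (tr(Y·insDeriv_X hol w)·tr ρ(hol v) + tr(Y ρ(hol w))·tr(insDeriv_X hol v)) dμ_β = β ∫ tr(Y ρ(hol w))·tr ρ(hol v)·(−½ plaqIns_X) dμ_β`.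
[folklore] -/
theorem sd_pair₂ [NeZero L] (β : ℝ) (x : Site d L) (μ : Fin d) {k : ℝ → G} (hk : ∀ s t, k (s + t) = k s * k t)
    {X : Matrix (Fin r.N) (Fin r.N) ℂ} (hX : ∀ t, r.ρ (k t) = exp ((t : ℂ) • X)) (hXs : Xᴴ = -X)
    (Y : Matrix (Fin r.N) (Fin r.N) ℂ) (x₀ : Site d L) (w : Word d) (x₁ : Site d L) (v : Word d) :
    ∫ U, ((Y * insDeriv r.ρ (x, μ) X U x₀ w).trace * (r.ρ (wordHolonomy U x₁ v)).trace +
        (Y * r.ρ (wordHolonomy U x₀ w)).trace * (insDeriv r.ρ (x, μ) X U x₁ v).trace)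
        ∂(wilsonMeasure (d := d) (L := L) r.ρ β) =
      (β : ℂ) * ∫ U, (Y * r.ρ (wordHolonomy U x₀ w)).trace * (r.ρ (wordHolonomy U x₁ v)).trace *
        (-(1 / 2) * plaqIns r.ρ X U x μ) ∂(wilsonMeasure (d := d) (L := L) r.ρ β) := by
  have h := integral_shiftDeriv_eq_wilson_complex r β (x, μ) hk
    (fun U => (Y * r.ρ (wordHolonomy U x₀ w)).trace * (r.ρ (wordHolonomy U x₁ v)).trace)
    (fun U => (Y * insDeriv r.ρ (x, μ) X U x₀ w).trace * (r.ρ (wordHolonomy U x₁ v)).trace +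
      (Y * r.ρ (wordHolonomy U x₀ w)).trace * (insDeriv r.ρ (x, μ) X U x₁ v).trace)
    (((continuous_const.mul (r.continuous.comp (continuous_wordHolonomy x₀ w))).matrix_trace).mul
      (continuous_trace_wordHolonomy r x₁ v))
    ((((continuous_const.mul (continuous_insDeriv (e := (x, μ)) (X := X) r.continuous x₀ w)).matrix_trace).mul
      (continuous_trace_wordHolonomy r x₁ v)).add
      (((continuous_const.mul (r.continuous.comp (continuous_wordHolonomy x₀ w))).matrix_trace).mul
        (continuous_insDeriv (e := (x, μ)) (X := X) r.continuous x₁ v).matrix_trace))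
    (fun U => by
      have h1 : HasDerivAt (fun t : ℝ => (Y * r.ρ (wordHolonomy (Function.update U (x, μ) (k t * U (x, μ))) x₀ w)).trace)
          ((Y * insDeriv r.ρ (x, μ) X U x₀ w).trace) 0 := by
        have hd := (traceMulLeftCLM Y).hasFDerivAt.comp_hasDerivAt (0 : ℝ)
          (hasDerivAt_wordHolonomy (e := (x, μ)) hk hX U x₀ w)
        simpa [Function.comp_def] using hd.congr_deriv (traceMulLeftCLM_apply Y _)
      have h2 : HasDerivAt (fun t : ℝ => (r.ρ (wordHolonomy (Function.update U (x, μ) (k t * U (x, μ))) x₁ v)).trace)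
          ((insDeriv r.ρ (x, μ) X U x₁ v).trace) 0 := by
        have hd := (traceMulLeftCLM (1 : Matrix (Fin r.N) (Fin r.N) ℂ)).hasFDerivAt.comp_hasDerivAt (0 : ℝ)
          (hasDerivAt_wordHolonomy (e := (x, μ)) hk hX U x₁ v)
        simpa [Function.comp_def, Matrix.one_mul] using hd.congr_deriv (traceMulLeftCLM_apply 1 _)
      have h12 := h1.mul h2
      simp only [shift_zero hk] at h12
      simpa only [Pi.mul_def] using h12)
    (actionDeriv r.ρ (x, μ) X) (continuous_actionDeriv (e := (x, μ)) (X := X) r.continuous)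
    (fun U => hasDerivAt_wilsonAction (e := (x, μ)) hk hX U)
  rw [h]
  congr 1
  refine integral_congr_ae (ae_of_all _ fun U => ?_)
  simp only [actionDeriv_eq_plaqIns hXs r.mem_unitary U x μ]

/-- THE TWO-WORD PAIR IDENTITY for the direction `X` (marked word `w` from `x₀`, spectator `v` from `x₁`, edge
`(x, μ)`, coupling `β`), as a predicate in `X` (used to organise polarisation — not a named fact). [folklore] -/
def SDPair₂ [NeZero L] (β : ℝ) (x : Site d L) (μ : Fin d) (x₀ : Site d L) (w : Word d) (x₁ : Site d L) (v : Word d)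
    (X : Matrix (Fin r.N) (Fin r.N) ℂ) : Prop :=
  ∀ Y : Matrix (Fin r.N) (Fin r.N) ℂ,
    ∫ U, ((Y * insDeriv r.ρ (x, μ) X U x₀ w).trace * (r.ρ (wordHolonomy U x₁ v)).trace +
        (Y * r.ρ (wordHolonomy U x₀ w)).trace * (insDeriv r.ρ (x, μ) X U x₁ v).trace)
        ∂(wilsonMeasure (d := d) (L := L) r.ρ β) =
      (β : ℂ) * ∫ U, (Y * r.ρ (wordHolonomy U x₀ w)).trace * (r.ρ (wordHolonomy U x₁ v)).trace *
        (-(1 / 2) * plaqIns r.ρ X U x μ) ∂(wilsonMeasure (d := d) (L := L) r.ρ β)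

/-- `sd_pair₂` restated: admissible skew-Hermitian directions satisfy the two-word pair identity. [folklore] -/
theorem sdPair₂_of_oneParam [NeZero L] (β : ℝ) (x : Site d L) (μ : Fin d) (x₀ : Site d L) (w : Word d)
    (x₁ : Site d L) (v : Word d) {X : Matrix (Fin r.N) (Fin r.N) ℂ} (hXs : Xᴴ = -X) {k : ℝ → G}
    (hk : ∀ s t, k (s + t) = k s * k t) (hX : ∀ t, r.ρ (k t) = exp ((t : ℂ) • X)) :
    SDPair₂ r β x μ x₀ w x₁ v X :=
  fun Y => sd_pair₂ r β x μ hk hX hXs Y x₀ w x₁ v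

omit [CompactSpace G] [MeasurableSpace G] [BorelSpace G] in
/-- Continuity of the left integrand of the two-word identity. [folklore] -/
theorem continuous_lhs₂ (Y X : Matrix (Fin r.N) (Fin r.N) ℂ) (x : Site d L) (μ : Fin d) (x₀ : Site d L) (w : Word d)
    (x₁ : Site d L) (v : Word d) : Continuous fun U : GaugeConfig d L G =>
      (Y * insDeriv r.ρ (x, μ) X U x₀ w).trace * (r.ρ (wordHolonomy U x₁ v)).trace +
        (Y * r.ρ (wordHolonomy U x₀ w)).trace * (insDeriv r.ρ (x, μ) X U x₁ v).trace :=
  (((continuous_const.mul (continuous_insDeriv (e := (x, μ)) (X := X) r.continuous x₀ w)).matrix_trace).mul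
    (continuous_trace_wordHolonomy r x₁ v)).add
    (((continuous_const.mul (r.continuous.comp (continuous_wordHolonomy x₀ w))).matrix_trace).mul
      (continuous_insDeriv (e := (x, μ)) (X := X) r.continuous x₁ v).matrix_trace)

omit [CompactSpace G] [MeasurableSpace G] [BorelSpace G] in
/-- Continuity of the right integrand of the two-word identity. [folklore] -/
theorem continuous_rhs₂ (Y X : Matrix (Fin r.N) (Fin r.N) ℂ) (x : Site d L) (μ : Fin d) (x₀ : Site d L) (w : Word d)
    (x₁ : Site d L) (v : Word d) : Continuous fun U : GaugeConfig d L G =>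
      (Y * r.ρ (wordHolonomy U x₀ w)).trace * (r.ρ (wordHolonomy U x₁ v)).trace * (-(1 / 2) * plaqIns r.ρ X U x μ) :=
  (((continuous_const.mul (r.continuous.comp (continuous_wordHolonomy x₀ w))).matrix_trace).mul
    (continuous_trace_wordHolonomy r x₁ v)).mul (continuous_const.mul (continuous_plaqIns r X x μ))

/-- **Polarisation step** for the two-word identity (both sides are `ℂ`-linear in `X`). [folklore] -/
theorem sdPair₂_of_parts [NeZero L] (β : ℝ) (x : Site d L) (μ : Fin d) (x₀ : Site d L) (w : Word d) (x₁ : Site d L)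
    (v : Word d) (X : Matrix (Fin r.N) (Fin r.N) ℂ) (hPA : SDPair₂ r β x μ x₀ w x₁ v ((1 / 2 : ℂ) • (X - Xᴴ)))
    (hPB : SDPair₂ r β x μ x₀ w x₁ v ((Complex.I / 2) • (X + Xᴴ))) : SDPair₂ r β x μ x₀ w x₁ v X := by
  set A : Matrix (Fin r.N) (Fin r.N) ℂ := (1 / 2 : ℂ) • (X - Xᴴ) with hA
  set B : Matrix (Fin r.N) (Fin r.N) ℂ := (Complex.I / 2) • (X + Xᴴ) with hB
  have hXAB : X = A + (-Complex.I) • B := eq_skewPart_add X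
  clear_value A B
  intro Y
  have hiA := integrable_of_continuous r β (continuous_lhs₂ r Y A x μ x₀ w x₁ v)
  have hiB := integrable_of_continuous r β (continuous_lhs₂ r Y B x μ x₀ w x₁ v)
  have hjA := integrable_of_continuous r β (continuous_rhs₂ r Y A x μ x₀ w x₁ v)
  have hjB := integrable_of_continuous r β (continuous_rhs₂ r Y B x μ x₀ w x₁ v)
  have hl : ∀ U : GaugeConfig d L G,
      (Y * insDeriv r.ρ (x, μ) X U x₀ w).trace * (r.ρ (wordHolonomy U x₁ v)).trace +
          (Y * r.ρ (wordHolonomy U x₀ w)).trace * (insDeriv r.ρ (x, μ) X U x₁ v).trace =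
        ((Y * insDeriv r.ρ (x, μ) A U x₀ w).trace * (r.ρ (wordHolonomy U x₁ v)).trace +
            (Y * r.ρ (wordHolonomy U x₀ w)).trace * (insDeriv r.ρ (x, μ) A U x₁ v).trace) +
          (-Complex.I) * ((Y * insDeriv r.ρ (x, μ) B U x₀ w).trace * (r.ρ (wordHolonomy U x₁ v)).trace +
            (Y * r.ρ (wordHolonomy U x₀ w)).trace * (insDeriv r.ρ (x, μ) B U x₁ v).trace) := by
    intro U
    rw [hXAB, insDeriv_add, insDeriv_smul, insDeriv_add, insDeriv_smul, Matrix.mul_add, Matrix.mul_smul,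
      Matrix.trace_add, Matrix.trace_smul, Matrix.trace_add, Matrix.trace_smul, smul_eq_mul, smul_eq_mul]
    ring
  have hr : ∀ U : GaugeConfig d L G,
      (Y * r.ρ (wordHolonomy U x₀ w)).trace * (r.ρ (wordHolonomy U x₁ v)).trace * (-(1 / 2) * plaqIns r.ρ X U x μ) =
        (Y * r.ρ (wordHolonomy U x₀ w)).trace * (r.ρ (wordHolonomy U x₁ v)).trace * (-(1 / 2) * plaqIns r.ρ A U x μ) +
          (-Complex.I) * ((Y * r.ρ (wordHolonomy U x₀ w)).trace * (r.ρ (wordHolonomy U x₁ v)).trace *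
            (-(1 / 2) * plaqIns r.ρ B U x μ)) := by
    intro U
    rw [hXAB, plaqIns_add, plaqIns_smul]
    ring
  simp_rw [hl, hr]
  rw [integral_add hiA (hiB.const_mul _), integral_const_mul, integral_add hjA (hjB.const_mul _),
    integral_const_mul, hPA Y, hPB Y]
  ring

/-- **Polarisation (`𝔰𝔲`-type)** for the two-word identity. [folklore] -/
theorem sdPair₂_of_traceless [NeZero L] (β : ℝ) (x : Site d L) (μ : Fin d) (x₀ : Site d L) (w : Word d)
    (x₁ : Site d L) (v : Word d)
    (hadm : ∀ X : Matrix (Fin r.N) (Fin r.N) ℂ, Xᴴ = -X → X.trace = 0 → SDPair₂ r β x μ x₀ w x₁ v X)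
    (X : Matrix (Fin r.N) (Fin r.N) ℂ) (hX : X.trace = 0) : SDPair₂ r β x μ x₀ w x₁ v X :=
  sdPair₂_of_parts r β x μ x₀ w x₁ v X (hadm _ (conjTranspose_skewPart X) (trace_parts_eq_zero hX _).1)
    (hadm _ (conjTranspose_iHermPart X) (trace_parts_eq_zero hX _).2)

/-- **Polarisation (`𝔲`-type)** for the two-word identity. [folklore] -/
theorem sdPair₂_of_skew [NeZero L] (β : ℝ) (x : Site d L) (μ : Fin d) (x₀ : Site d L) (w : Word d) (x₁ : Site d L)
    (v : Word d) (hadm : ∀ X : Matrix (Fin r.N) (Fin r.N) ℂ, Xᴴ = -X → SDPair₂ r β x μ x₀ w x₁ v X)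
    (X : Matrix (Fin r.N) (Fin r.N) ℂ) : SDPair₂ r β x μ x₀ w x₁ v X :=
  sdPair₂_of_parts r β x μ x₀ w x₁ v X (hadm _ (conjTranspose_skewPart X)) (hadm _ (conjTranspose_iHermPart X))

end SDPair₂


end Summit.QuantumFields.GaugeBoot

end
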